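import Literature.Probability.Percolation.TriBoxCrossingUpperBound
import Literature.Probability.Percolation.QuadCrossingFourArmShadow
import HarnessLib

/-!
# Traces of lattice walks: compactness, distance to the vertices, colour disjointness

Topic: Probability / Percolation.  Small complements to `LatticeTraceGeometry.lean`,
`LatticePathArcs.lean` (`ℤ²` and its planar dual `ℤ² + (½, ½)` at mesh `δ`) and
`TriBoxCrossingUpperBound.lean` (`𝕋` at mesh `δ`), used when drawn lattice paths are compared with
continuum crossings in a chart (plus-position blocking, Bollobás–Riordan, *Percolation* (2006),
Ch. 7, Claim 19; "an open path cannot cross an open dual path", Ch. 3 §1 and Ch. 5 p. 111):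

* `exists_dist_meshPoint_le_of_mem_meshTrace`, `exists_dist_dualScale_le_of_mem_image_walkTrace`,
  `exists_dist_triMeshPoint_le_of_mem_triWalkTrace` — every point of the drawn trace of a walk is
  within one mesh `δ` of a drawn vertex of the walk;
* `isCompact_meshTrace`, `isCompact_image_dualScale_walkTrace`, `isCompact_triWalkTrace` — drawn
  traces are compact (finite unions of segments; `isCompact_walkTrace`);
* `disjoint_meshTrace_image_dualScale_walkTrace` — at every mesh `δ ≠ 0` the trace of an `ω`-open
  primal walk misses the planar dual trace of a walk open in `dualConfig ω`
  (`disjoint_walkTrace_image_walkTrace` rescaled);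
* `disjoint_triWalkTrace_of_forall_not_mem` — on `δ𝕋` the traces of a walk through sites of `χ`
  and of a walk through sites off `χ` are disjoint (`disjoint_segment_triWalkTrace` edge by edge).

## References
* B. Bollobás, O. Riordan, *Percolation*, CUP (2006), Ch. 3 §1, Ch. 5 p. 111, Ch. 7 §2.
  [BollobasRiordan2006]
-/

namespace Literature.Probability.Percolation

open Set Metric LatticeModels

noncomputable section

/-! ### Every trace point is within one mesh of a vertex -/

/-- A point of the mesh trace of a `ℤ²`-walk is within `|δ|` of the mesh point of some vertex of
the walk. [folklore] -/
theorem exists_dist_meshPoint_le_of_mem_meshTrace {δ : ℝ} {u v : Site 2} {π : (zdGraph 2).Walk u v}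
    {p : ℂ} (hp : p ∈ meshTrace δ π) : ∃ w ∈ π.support, dist p (meshPoint δ w) ≤ |δ| := by
  obtain ⟨e, he, hpe⟩ := mem_meshTrace_iff.1 hp
  revert he hpe
  induction e using Sym2.ind with
  | h s t =>
    intro he hpe
    rw [← segment_meshPoint_eq_image] at hpe
    exact ⟨s, π.fst_mem_support_of_mem_edges he, dist_le_of_mem_segment_of_mem_segment
      (π.adj_of_mem_edges he) (right_mem_segment ℝ _ _) hpe⟩

/-- A point of the planar dual trace (at mesh `δ ≥ 0`) of a `ℤ²`-walk is within `δ` of the dual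
position of some vertex of the walk. [folklore] -/
theorem exists_dist_dualScale_le_of_mem_image_walkTrace {δ : ℝ} (hδ : 0 ≤ δ) {u v : Site 2}
    {Q : (zdGraph 2).Walk u v} {p : ℂ} (hp : p ∈ dualScale δ '' walkTrace Q) :
    ∃ w ∈ Q.support, dist p (dualScale δ (Site.toComplex w)) ≤ δ := by
  obtain ⟨q, hq, rfl⟩ := hp
  obtain ⟨e, he, hqe⟩ := mem_walkTrace_iff.1 hq
  revert he hqe
  induction e using Sym2.ind with
  | h s t =>
    intro he hqe
    exact ⟨s, Q.fst_mem_support_of_mem_edges he, dist_le_of_mem_image_dualScale_edgeTrace hδ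
      (Q.adj_of_mem_edges he) (mem_image_of_mem _ hqe)⟩

/-- A point of the trace of a `𝕋`-walk at mesh `δ` is within `|δ|` of the mesh point of some
vertex of the walk. [folklore] -/
theorem exists_dist_triMeshPoint_le_of_mem_triWalkTrace {δ : ℝ} {u v : Site 2}
    {W : triGraph.Walk u v} {p : ℂ} (hp : p ∈ triWalkTrace δ W) :
    ∃ w ∈ W.support, dist p (triMeshPoint δ w) ≤ |δ| := by
  obtain ⟨e, he, hpe⟩ := mem_triWalkTrace_iff.1 hp
  revert he hpe
  induction e using Sym2.ind with
  | h s t =>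
    intro he hpe
    rw [triEdgeSeg_mk] at hpe
    refine ⟨s, W.fst_mem_support_of_mem_edges he, ?_⟩
    have := segment_triMeshPoint_subset_closedBall (δ := δ) (W.adj_of_mem_edges he) hpe
    rwa [mem_closedBall] at this

/-! ### Compactness of drawn traces -/

/-- The mesh trace of a `ℤ²`-walk is compact. [folklore] -/
theorem isCompact_meshTrace (δ : ℝ) {u v : Site 2} (π : (zdGraph 2).Walk u v) :
    IsCompact (meshTrace δ π) :=
  (isCompact_walkTrace π).image (meshScale δ).continuous_of_finiteDimensional

/-- The planar dual trace of a `ℤ²`-walk is compact. [folklore] -/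
theorem isCompact_image_dualScale_walkTrace (δ : ℝ) {u v : Site 2} (Q : (zdGraph 2).Walk u v) :
    IsCompact (dualScale δ '' walkTrace Q) :=
  (isCompact_walkTrace Q).image (continuous_dualScale δ)

/-- The trace of a `𝕋`-walk at mesh `δ` is compact (a finite union of segments). [folklore] -/
theorem isCompact_triWalkTrace (δ : ℝ) {u v : Site 2} (W : triGraph.Walk u v) :
    IsCompact (triWalkTrace δ W) := by
  refine (W.edges.finite_toSet).isCompact_biUnion fun e _ => ?_
  induction e using Sym2.ind with
  | h x y =>
    rw [triEdgeSeg_mk, segment_eq_image']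
    exact isCompact_Icc.image (by fun_prop)

/-! ### Colour disjointness of drawn traces -/

/-- **An open primal trace misses a dual-open dual trace, at every mesh `δ ≠ 0`**: if every edge
of `π` is in `ω` and every edge of `Q` is open in `dualConfig ω`, then `δ · trace π` and the planar
dual trace `dualScale δ (trace Q)` are disjoint (Bollobás–Riordan 2006, Ch. 5 p. 111: "an open
edge of `ℤ²` cannot cross an open dual edge"). [cite: BollobasRiordan2006, Ch. 5 p. 111 (PDF page)] -/
theorem disjoint_meshTrace_image_dualScale_walkTrace {δ : ℝ} (hδ : δ ≠ 0)
    {ω : BondConfig (Site 2)} {a b c d : Site 2} {π : (zdGraph 2).Walk a b}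
    (hπ : ∀ e ∈ π.edges, e ∈ ω) {Q : (zdGraph 2).Walk c d}
    (hQ : ∀ e ∈ Q.edges, e ∈ dualConfig ω) :
    Disjoint (meshTrace δ π) (dualScale δ '' walkTrace Q) := by
  refine disjoint_left.2 fun p hp hp' => ?_
  obtain ⟨z, hz, rfl⟩ := (mem_image _ _ _).1 hp
  obtain ⟨q, hq, hzq⟩ := hp'
  have hδ' : (δ : ℂ) ≠ 0 := by exact_mod_cast hδ
  have hzq' : z = q + dualOffset := by
    rw [dualScale_apply, meshScale_apply, ← mul_add] at hzq
    exact (mul_left_cancel₀ hδ' hzq).symm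
  exact Set.disjoint_left.1 (disjoint_walkTrace_image_walkTrace hπ hQ) hz ⟨q, hq, hzq'.symm⟩

/-- **Traces of `𝕋`-walks of different colours are disjoint** (`δ ≠ 0`): a walk through sites of
`χ` and a walk through sites off `χ` have disjoint traces (Bollobás–Riordan 2006, Ch. 7 §2: an
open path and a closed path of `𝕋` cannot cross). [cite: BollobasRiordan2006, Ch. 7 §2] -/
theorem disjoint_triWalkTrace_of_forall_not_mem {δ : ℝ} (hδ : δ ≠ 0) {χ : Set (Site 2)}
    {a b c d : Site 2} {W₁ : triGraph.Walk a b} (h₁ : ∀ z ∈ W₁.support, z ∈ χ)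
    {W₂ : triGraph.Walk c d} (h₂ : ∀ z ∈ W₂.support, z ∉ χ) :
    Disjoint (triWalkTrace δ W₂) (triWalkTrace δ W₁) := by
  refine disjoint_left.2 fun p hp hp' => ?_
  obtain ⟨e, he, hpe⟩ := mem_triWalkTrace_iff.1 hp
  revert he hpe
  induction e using Sym2.ind with
  | h s t =>
    intro he hpe
    rw [triEdgeSeg_mk] at hpe
    exact Set.disjoint_left.1 (disjoint_segment_triWalkTrace hδ h₁ (W₂.adj_of_mem_edges he)
      (h₂ s (W₂.fst_mem_support_of_mem_edges he)) (h₂ t (W₂.snd_mem_support_of_mem_edges he)))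
      hpe hp'

end

end Literature.Probability.Percolation
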